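import Mathlib
import Literature.Probability.RandomPlanarGeometry.PlanarDomains

/-!
# No Dobrushin domain has a frontier with a cut point (negative lemma for crux `ObservableToSLE`,
stmt-CriticalPhenomena-10472, obstruction W1: the SAW's slit domains `Ω ∖ γ[0,t]` are the carrier of
no `DobrushinDomain`, so `HexObservableLimit` is silent on them).
-/

open Set Filter Topology Literature.Probability.RandomPlanarGeometry

namespace Summit.CriticalPhenomena.SAWScalingLimit.Theorems.ObservableToSLE.Negative

/-- The boundary loop of a Jordan domain takes the same value at `t` and at `fract t`. [folklore] -/
theorem boundary_fract (D : JordanDomain) (t : ℝ) : D.boundary (Int.fract t) = D.boundary t := by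
  rw [← Int.self_sub_floor]
  simpa using D.periodic_boundary.sub_int_mul_eq (x := t) ⌊t⌋

/-- A Jordan loop has no cut points: removing one boundary point `boundary t₀` from the frontier of
a Jordan domain leaves the image of the open period `(t₀, t₀ + 1)`. [folklore] -/
theorem frontier_diff_boundary_eq (D : JordanDomain) (t₀ : ℝ) :
    frontier D.carrier \ {D.boundary t₀} = D.boundary '' Set.Ioo t₀ (t₀ + 1) := by
  rw [← D.range_boundary]
  ext z
  constructor
  · rintro ⟨⟨t, rfl⟩, hne⟩
    have hne : D.boundary t ≠ D.boundary t₀ := hne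
    set n : ℤ := ⌊t - t₀⌋ with hn
    have hper : D.boundary (t - n * 1) = D.boundary t := D.periodic_boundary.sub_int_mul_eq n
    refine ⟨t - n, ⟨?_, ?_⟩, by simpa using hper⟩
    · rcases (show t₀ ≤ t - n by have := Int.floor_le (t - t₀); linarith).lt_or_eq with h | h
      · exact h
      · exfalso
        apply hne
        rw [← hper]
        simp [← h]
    · have := Int.lt_floor_add_one (t - t₀)
      linarith
  · rintro ⟨t, ⟨ht1, ht2⟩, rfl⟩
    refine ⟨Set.mem_range_self t, fun heq => ?_⟩
    have heq : D.boundary t = D.boundary t₀ := heq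
    rw [← boundary_fract D t, ← boundary_fract D t₀] at heq
    have hfr : ∀ r : ℝ, Int.fract r ∈ Set.Ico (0 : ℝ) 1 := fun r =>
      ⟨Int.fract_nonneg r, Int.fract_lt_one r⟩
    have hinj := D.injOn_boundary (hfr t) (hfr t₀) heq
    obtain ⟨z, hz⟩ := Int.fract_eq_fract.1 hinj
    have h0 : (0 : ℝ) < z := by rw [← hz]; linarith
    have h1 : (z : ℝ) < 1 := by rw [← hz]; linarith
    have : (0 : ℤ) < z := by exact_mod_cast h0
    have : z < (1 : ℤ) := by exact_mod_cast h1
    omega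

/-- Hence the frontier of a Jordan domain minus any one of its points is preconnected. [folklore] -/
theorem isPreconnected_frontier_diff (D : JordanDomain) {p : ℂ} (hp : p ∈ frontier D.carrier) :
    IsPreconnected (frontier D.carrier \ {p}) := by
  rw [← D.range_boundary] at hp
  obtain ⟨t₀, rfl⟩ := hp
  rw [frontier_diff_boundary_eq D t₀]
  exact isPreconnected_Ioo.image _ D.continuous_boundary.continuousOn

/-- No Dobrushin domain has a frontier with a cut point: a set `U` whose frontier is disconnected by
removing one of its points is the carrier of no `DobrushinDomain` (applies to every slit domain
`Ω ∖ γ[0,t]` of the martingale-observable scheme). [folklore] -/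
theorem carrier_ne_of_cutPoint (D : DobrushinDomain) {U : Set ℂ} {p : ℂ} (hp : p ∈ frontier U)
    (hcut : ¬ IsPreconnected (frontier U \ {p})) : D.carrier ≠ U := by
  rintro rfl
  exact hcut (isPreconnected_frontier_diff D.toJordanDomain hp)

end Summit.CriticalPhenomena.SAWScalingLimit.Theorems.ObservableToSLE.Negative
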